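import Mathlib
import Summits.Ventures.DiscreteObjects.Mahler.KroneckerTwoCos
import Summits.Ventures.DiscreteObjects.Mahler.LehmerExactMeasure

/-!
# The Mahler measure of a reciprocal polynomial from its trace polynomial (venture `DiscreteObjects`, target L)

Cell `pub-namedobj`, seat `pub-namedobj-mahler` (gen 10). Framing: lottery ticket; floor = certified
bounds/negative ranges.

A generic KERNEL CERTIFICATE for the "Q(y) real-root method" of the census (engine E3) and for every
Salem-type core: for a monic `Q ∈ ℤ[X]` of degree `d ≥ 1`, the reciprocal lift
`P = traceLift Q = x^d Q(x + 1/x)` (gen 8, `KroneckerTwoCos`) factors over `ℂ` as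
`∏_{Q(y)=0} (x² - y x + 1)`, hence `M(P) = ∏_{Q(y)=0} M(x² - yx + 1)`; for a REAL root `y` this factor is
`1` if `|y| ≤ 2` and `(|y| + √(y² - 4))/2` if `|y| > 2`.  So when all roots of `Q` are real (supplied as `d`
distinct real numbers, e.g. from `d` sign changes), `M(traceLift Q)` is an explicit product, and in the
Salem case (one root of modulus `> 2`) `M(P) + M(P)⁻¹ = |y₁|` — a rational enclosure of `y₁` certifies
`M(P)` (cf. `LehmerExactMeasure`, which is the instance `Q = y⁵+y⁴-5y³-5y²+4y+3`).

* `mahlerMeasure_quad_of_lt_neg_two`, `mahlerMeasure_quad_real` — `M(x² - yx + 1)` for real `y`;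
* `traceLift_map_eq_prod` — `(traceLift Q) = ∏_{Q(y)=0} (x² - yx + 1)` over `ℂ`;
* `roots_map_eq_of_real_roots` — `d` distinct real roots exhaust the roots of a degree-`d` polynomial;
* `intMahlerMeasure_traceLift_of_real_roots` — the product formula;
* `salem_traceLift_certificate` — one root `|y₁| > 2`, the others in `[-2, 2]`:
  `M(traceLift Q) = (|y₁| + √(y₁² - 4))/2` and `M + M⁻¹ = |y₁|`.
-/

namespace Summit.Ventures.DiscreteObjects.Mahler

open Polynomial

/-! ### Quadratic factors `x² - y x + 1` with real `y` -/

/-- For `y < -2`: `M(x² - yx + 1) = (-y + √(y²-4))/2`. -/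
theorem mahlerMeasure_quad_of_lt_neg_two {y : ℝ} (h : y < -2) :
    (X ^ 2 - C (y : ℂ) * X + 1 : ℂ[X]).mahlerMeasure = (-y + Real.sqrt (y ^ 2 - 4)) / 2 := by
  have hpos : 0 ≤ y ^ 2 - 4 := by nlinarith
  set t : ℝ := Real.sqrt (y ^ 2 - 4) with ht
  have ht2 : t ^ 2 = y ^ 2 - 4 := by rw [ht]; exact Real.sq_sqrt hpos
  have ht0 : 0 ≤ t := Real.sqrt_nonneg _
  have hty : t < -y := by nlinarith
  set r₁ : ℝ := (y - t) / 2 with hr₁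
  set r₂ : ℝ := (y + t) / 2 with hr₂
  have hsum : r₁ + r₂ = y := by rw [hr₁, hr₂]; ring
  have hprod : r₁ * r₂ = 1 := by rw [hr₁, hr₂]; nlinarith
  have hr1 : r₁ ≤ -1 := by rw [hr₁]; linarith
  have hr2neg : r₂ < 0 := by rw [hr₂]; linarith
  have hr2le : -1 ≤ r₂ := by nlinarith
  have hfac : (X ^ 2 - C (y : ℂ) * X + 1 : ℂ[X]) = (X - C (r₁ : ℂ)) * (X - C (r₂ : ℂ)) := by
    have : (X - C (r₁ : ℂ)) * (X - C (r₂ : ℂ)) = X ^ 2 - C ((r₁ : ℂ) + r₂) * X + C ((r₁ : ℂ) * r₂) := by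
      rw [map_add, map_mul]; ring
    rw [this]
    have h1 : (r₁ : ℂ) + r₂ = (y : ℂ) := by exact_mod_cast hsum
    have h2 : (r₁ : ℂ) * r₂ = 1 := by exact_mod_cast hprod
    rw [h1, h2, map_one]
  rw [hfac, mahlerMeasure_mul, mahlerMeasure_X_sub_C, mahlerMeasure_X_sub_C, Complex.norm_real,
    Complex.norm_real, Real.norm_of_nonpos (by linarith), Real.norm_of_nonpos hr2neg.le,
    max_eq_right (by linarith), max_eq_left (by linarith), mul_one, hr₁]
  ring

/-- For `|y| ≤ 2`: `M(x² - yx + 1) = 1` (including `y = ±2`: `(x ∓ 1)²`). -/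
theorem mahlerMeasure_quad_of_abs_le_two {y : ℝ} (h : |y| ≤ 2) :
    (X ^ 2 - C (y : ℂ) * X + 1 : ℂ[X]).mahlerMeasure = 1 := by
  rcases abs_le.mp h with ⟨h1, h2⟩
  rcases lt_or_eq_of_le h2 with h2 | h2
  · rcases lt_or_eq_of_le h1 with h1 | h1
    · exact mahlerMeasure_quad_of_abs_lt_two h1 h2
    · -- `y = -2`: `(x + 1)²`
      rw [← h1]
      have : (X ^ 2 - C (((-2 : ℝ)) : ℂ) * X + 1 : ℂ[X]) = (X - C (-1)) * (X - C (-1)) := by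
        simp only [Complex.ofReal_neg, Complex.ofReal_ofNat, map_neg, map_ofNat, map_one]; ring
      rw [this, mahlerMeasure_mul, mahlerMeasure_X_sub_C]; simp
  · -- `y = 2`: `(x - 1)²`
    rw [h2]
    have : (X ^ 2 - C (((2 : ℝ)) : ℂ) * X + 1 : ℂ[X]) = (X - C 1) * (X - C 1) := by
      simp only [Complex.ofReal_ofNat, map_one, map_ofNat]; ring
    rw [this, mahlerMeasure_mul, mahlerMeasure_X_sub_C]; simp

/-- **`M(x² - yx + 1)` for real `y`:** `1` if `|y| ≤ 2`, `(|y| + √(y² - 4))/2` otherwise. -/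
theorem mahlerMeasure_quad_real (y : ℝ) :
    (X ^ 2 - C (y : ℂ) * X + 1 : ℂ[X]).mahlerMeasure =
      if |y| ≤ 2 then 1 else (|y| + Real.sqrt (y ^ 2 - 4)) / 2 := by
  by_cases h : |y| ≤ 2
  · rw [if_pos h]; exact mahlerMeasure_quad_of_abs_le_two h
  · rw [if_neg h]
    push Not at h
    rcases lt_or_gt_of_ne (show y ≠ 0 by intro h0; rw [h0, abs_zero] at h; linarith) with hy | hy
    · have hy2 : y < -2 := by rw [abs_of_neg hy] at h; linarith
      rw [mahlerMeasure_quad_of_lt_neg_two hy2, abs_of_neg hy]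
    · have hy2 : 2 < y := by rw [abs_of_pos hy] at h; exact h
      rw [mahlerMeasure_quad_of_two_lt hy2, abs_of_pos hy]

/-! ### The lift `traceLift Q` over `ℂ` -/

/-- `(traceLift Q)(0) = lc(Q)`. -/
theorem eval_zero_traceLift (Q : ℤ[X]) : (traceLift Q).eval 0 = Q.leadingCoeff := by
  rw [traceLift, eval_finsetSum, Finset.sum_eq_single Q.natDegree]
  · simp only [Nat.sub_self, pow_zero, mul_one, eval_mul, eval_C, eval_pow, eval_add, eval_X, eval_one,
      zero_pow two_ne_zero, zero_add, one_pow]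
    rfl
  · intro j hj _
    rw [Finset.mem_range] at hj
    have : Q.natDegree - j ≠ 0 := by omega
    simp only [eval_mul, eval_C, eval_pow, eval_X, zero_pow this, mul_zero, zero_mul]
  · intro h
    exact absurd (Finset.mem_range.mpr (Nat.lt_succ_self _)) h

/-- **Factorisation of the lift over `ℂ`:** for monic `Q` of degree `d ≥ 1`,
`traceLift Q = ∏_{Q(y)=0} (x² - y x + 1)` (complex roots with multiplicity). -/
theorem traceLift_map_eq_prod {Q : ℤ[X]} (hQ : Q.Monic) :
    (traceLift Q).map (Int.castRingHom ℂ) =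
      (((Q.map (Int.castRingHom ℂ)).roots).map fun y => (X ^ 2 - C y * X + 1 : ℂ[X])).prod := by
  have hinj := (Int.castRingHom ℂ).injective_int
  set Qc := Q.map (Int.castRingHom ℂ) with hQc
  have hQcm : Qc.Monic := hQ.map _
  have hsplit : Qc = (Qc.roots.map fun y => X - C y).prod := (IsAlgClosed.splits Qc).eq_prod_roots_of_monic hQcm
  have hcard : Multiset.card Qc.roots = Q.natDegree := by
    have hsp := (IsAlgClosed.splits Qc).natDegree_eq_card_roots
    rw [hQc, natDegree_map_eq_of_injective hinj] at hsp
    exact hsp.symm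
  apply Polynomial.funext
  intro x
  rcases eq_or_ne x 0 with rfl | hx
  · rw [eval_map, eval₂_at_zero, coeff_zero_eq_eval_zero, eval_zero_traceLift, hQ.leadingCoeff, map_one,
      eval_multiset_prod, Multiset.map_map]
    have : (Qc.roots.map ((fun p : ℂ[X] => p.eval 0) ∘ fun y => (X ^ 2 - C y * X + 1 : ℂ[X]))) =
        Qc.roots.map fun _ => (1 : ℂ) := Multiset.map_congr rfl fun y _ => by simp
    rw [this, Multiset.map_const', Multiset.prod_replicate, one_pow]
  · rw [eval_traceLift hx, eval_multiset_prod, Multiset.map_map]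
    have hQe : aeval (x + x⁻¹) Q = Qc.eval (x + x⁻¹) := by
      rw [hQc, ← algebraMap_int_eq, eval_map_algebraMap]
    rw [hQe]
    conv_lhs => rw [hsplit, eval_multiset_prod, Multiset.map_map]
    rw [← hcard, ← Multiset.prod_replicate, ← Multiset.map_const', ← Multiset.prod_map_mul]
    congr 1
    apply Multiset.map_congr rfl
    intro y _
    simp only [Function.comp_apply, eval_sub, eval_X, eval_C, eval_add, eval_mul, eval_pow, eval_one]
    field_simp
    ring

/-- `M(traceLift Q) = ∏_{Q(y)=0} M(x² - yx + 1)` for monic `Q`. -/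
theorem intMahlerMeasure_traceLift {Q : ℤ[X]} (hQ : Q.Monic) :
    intMahlerMeasure (traceLift Q) =
      (((Q.map (Int.castRingHom ℂ)).roots).map fun y => (X ^ 2 - C y * X + 1 : ℂ[X]).mahlerMeasure).prod := by
  unfold intMahlerMeasure
  rw [traceLift_map_eq_prod hQ, prod_mahlerMeasure_eq_mahlerMeasure_prod, Multiset.map_map]
  rfl

/-- `d` distinct real roots of a degree-`d` integer polynomial are all its complex roots. -/
theorem roots_map_eq_of_real_roots {Q : ℤ[X]} (hQ0 : Q ≠ 0) (s : Multiset ℝ) (hs : s.Nodup)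
    (hcard : Multiset.card s = Q.natDegree) (hroot : ∀ y ∈ s, aeval (y : ℂ) Q = 0) :
    (Q.map (Int.castRingHom ℂ)).roots = s.map (fun y : ℝ => (y : ℂ)) := by
  have hinj := (Int.castRingHom ℂ).injective_int
  have hQc0 : Q.map (Int.castRingHom ℂ) ≠ 0 := (Polynomial.map_ne_zero_iff hinj).mpr hQ0
  have hnodup : (s.map (fun y : ℝ => (y : ℂ))).Nodup := hs.map Complex.ofReal_injective
  have hsub : s.map (fun y : ℝ => (y : ℂ)) ≤ (Q.map (Int.castRingHom ℂ)).roots := by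
    rw [Multiset.le_iff_subset hnodup]
    intro z hz
    obtain ⟨y, hy, rfl⟩ := Multiset.mem_map.mp hz
    rw [mem_roots hQc0, IsRoot.def, ← algebraMap_int_eq, eval_map_algebraMap]
    exact hroot y hy
  symm
  apply Multiset.eq_of_le_of_card_le hsub
  rw [Multiset.card_map, hcard, ← natDegree_map_eq_of_injective hinj Q]
  exact card_roots' _

/-- **Product formula.**  If the monic `Q ∈ ℤ[X]` of degree `d` has `d` distinct real roots `s`, then
`M(traceLift Q) = ∏_{y ∈ s} (if |y| ≤ 2 then 1 else (|y| + √(y²-4))/2)`. -/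
theorem intMahlerMeasure_traceLift_of_real_roots {Q : ℤ[X]} (hQ : Q.Monic) (s : Multiset ℝ)
    (hs : s.Nodup) (hcard : Multiset.card s = Q.natDegree) (hroot : ∀ y ∈ s, aeval (y : ℂ) Q = 0) :
    intMahlerMeasure (traceLift Q) =
      (s.map fun y => if |y| ≤ 2 then (1 : ℝ) else (|y| + Real.sqrt (y ^ 2 - 4)) / 2).prod := by
  rw [intMahlerMeasure_traceLift hQ, roots_map_eq_of_real_roots hQ.ne_zero s hs hcard hroot, Multiset.map_map]
  congr 1
  exact Multiset.map_congr rfl fun y _ => mahlerMeasure_quad_real y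

/-- **Salem certificate.**  Monic `Q ∈ ℤ[X]` of degree `d` with `d` distinct real roots `s`, of which
`y₁` has `|y₁| > 2` and all others `|y| ≤ 2`: then `M(traceLift Q) = (|y₁| + √(y₁²-4))/2 > 1` and
`M + M⁻¹ = |y₁|` — so a rational enclosure of `y₁` encloses `M(traceLift Q)`. -/
theorem salem_traceLift_certificate {Q : ℤ[X]} (hQ : Q.Monic) (s : Multiset ℝ) (hs : s.Nodup)
    (hcard : Multiset.card s = Q.natDegree) (hroot : ∀ y ∈ s, aeval (y : ℂ) Q = 0)
    {y₁ : ℝ} (hy₁ : y₁ ∈ s) (hbig : 2 < |y₁|) (hsmall : ∀ y ∈ s.erase y₁, |y| ≤ 2) :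
    intMahlerMeasure (traceLift Q) = (|y₁| + Real.sqrt (y₁ ^ 2 - 4)) / 2 ∧
      1 < intMahlerMeasure (traceLift Q) ∧
      intMahlerMeasure (traceLift Q) + (intMahlerMeasure (traceLift Q))⁻¹ = |y₁| := by
  have hM : intMahlerMeasure (traceLift Q) = (|y₁| + Real.sqrt (y₁ ^ 2 - 4)) / 2 := by
    rw [intMahlerMeasure_traceLift_of_real_roots hQ s hs hcard hroot, ← Multiset.cons_erase hy₁,
      Multiset.map_cons, Multiset.prod_cons, if_neg (not_le.mpr hbig)]
    have : ((s.erase y₁).map fun y => if |y| ≤ 2 then (1 : ℝ) else (|y| + Real.sqrt (y ^ 2 - 4)) / 2) =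
        (s.erase y₁).map fun _ => (1 : ℝ) := Multiset.map_congr rfl fun y hy => by rw [if_pos (hsmall y hy)]
    rw [this, Multiset.map_const', Multiset.prod_replicate, one_pow, mul_one]
  have hpos : 0 ≤ y₁ ^ 2 - 4 := by nlinarith [sq_abs y₁]
  set t := Real.sqrt (y₁ ^ 2 - 4) with ht
  have ht2 : t ^ 2 = y₁ ^ 2 - 4 := by rw [ht]; exact Real.sq_sqrt hpos
  have ht0 : 0 ≤ t := Real.sqrt_nonneg _
  have hta : t < |y₁| := by nlinarith [sq_abs y₁, abs_nonneg y₁]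
  have hprod : (|y₁| + t) / 2 * ((|y₁| - t) / 2) = 1 := by nlinarith [sq_abs y₁]
  refine ⟨hM, ?_, ?_⟩
  · rw [hM]; linarith
  · rw [hM]
    have hinv : ((|y₁| + t) / 2)⁻¹ = (|y₁| - t) / 2 := inv_eq_of_mul_eq_one_right hprod
    rw [hinv]; ring

end Summit.Ventures.DiscreteObjects.Mahler
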